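import Summits.QuantumFields.YangMills.Theorems.VirialFluxGapPerturbedHolonomyCubicTaylor
import Summits.QuantumFields.YangMills.Theorems.VirialFluxGapRingGaugeAction
import Summits.QuantumFields.YangMills.Theorems.VirialFluxGapRingZeroSet
import HarnessLib

/-!
# The twisted ring deficit in the PRODUCT EXPONENTIAL CHART at a zero: quadratic form − odd cubic form + `O(L⁴·m⁴)`
# (layer (B3-phase) of the DIRECT Laplace road to ⟨stmt-QuantumFields-24204⟩ `VirialFluxGap.SharpTwistedLaplace`)

Helper module (free-hands work of width seat ym-line-sfw-p2-w3 g56, cell ym-idea-1; `--supports 24204`).  Fix a zero `R = ((U)_i; g)` of the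
twisted deficit `F_z` (✓`ringDeficit_eq_zero_iff`: constant flat slices `U`, seam `g·tw_z U = U`) and perturb it in the LEFT product
exponential chart, `P_{i,e} = e^{A_{i,e}}·U_e`, `g'_x = e^{B_x}·g_x` with skew-Hermitian `2×2` matrices `A_{i,e}, B_x` of Frobenius norm `≤ m ≤ 1/4`
(stated for any ring `P` satisfying these matrix identities — no chart definition is needed).  Then

  ★★ `abs_ringDeficit_sub_chartModel_le`:  `|F_z(P) − Σ_terms (½‖S_t‖² − ½Re tr(S_t K_t))| ≤ 6720·L⁴·m⁴`,

the sum running over the `12L⁴` terms of the deficit (✓`ringDeficit_eq_matrix_sums`: `(2L−1)·3L³` temporal bonds, `3L³` twisted seam bonds,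
`2L·3L³` spatial plaquettes), each of which is the cost of a perturbed holonomy at a FLAT background and is expanded by
✓`ChartPhase.abs_cost_perturbed_holonomy_sub_cubic_le` (transported circulation `S_t`, signed commutator sum `K_t`; temporal bonds:
`S = A_{i,e} − A_{i+1,e}`; seam bond `e = (x,k)`: `S = A_{2L−1,e} + Ad_{U_e}B_{x+k} − Ad_{U_e g_{x+k} U_e⁻¹}A_{0,e} − B_x`; plaquette: the covariant
lattice curl).  The model is an explicit QUADRATIC form (`½Σ‖S_t‖²`, `0 ≤ · ≤ 96L⁴m²`) minus an explicit ODD CUBIC form (`|·| ≤ 288L⁴m³`), so along any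
linear slice `σ = Ψ_R ∘ ι` of the chart this is exactly the window datum `f∘σ − f(σ0) = ½⟪Ay,y⟫ + c + r` of
✓`QuantitativeLaplace.laplaceMethod_quantitative_of_eqOn` with `A₃ = 288L⁴`, `A₄ = 6720L⁴` (in the max-over-variables norm, `≤` the `ℓ²` norm).
* §1 `ringDeficit_eq_matrix_sums` (any `P`): `F_z = Σ temporal + Σ seam + Σ_i S(P_i)` in matrix form (✓`ringDeficit_eq_sums`, twist and gauge
  invariance of `S`, the Fin re-summation `Σ ½(S_i + S_{i+1}) + ½(S_last + S_0) = Σ S_i`);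
* §2 the three families against their models (`abs_temporalFamily_sub_le`, `abs_seamFamily_sub_le`, `abs_plaquetteFamily_sub_le`);
* §3 ★★ the assembly and the size bounds of the model (`chartModel_quadratic_le`, `abs_chartModel_cubic_le`).

Everything here is PROVED; no definitions, no named facts (namespace `Summit.QuantumFields.YangMills.Theorems.VirialFluxGap.ChartPhase`).
HONEST FRAMING: matrix bookkeeping; ⟨24204⟩, ⟨24319⟩ and every rung stay OPEN; the Yang–Mills mass gap (Clay) is NOT touched; no summit is
proved by a line.

## References
* M. Lüscher, Nucl. Phys. B219 (1983), §2 (expansion of the Wilson action around twist-eating flat connections). [Luscher1983]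
* K. W. Breitung, *Asymptotic Approximations for Probability Integrals*, LNM 1592 (1994), Lemma 7 p. 12. [Breitung1994]
-/

set_option autoImplicit false

noncomputable section

open scoped Matrix Matrix.Norms.Frobenius BigOperators
open NormedSpace
open Literature.MathematicalPhysics.QuantumFieldTheory hiding SU2
open Literature.MathematicalPhysics.QuantumLattice
open Summit.QuantumFields.YangMills.Theorems.FemtoTransferGap
open Summit.QuantumFields.YangMills.Theorems.FemtoTransferGap.TT
open Summit.QuantumFields.YangMills.Theorems.VirialFluxGap.RingDeficit
open Summit.QuantumFields.YangMills.Theorems.ToronValleyVolume.Lojasiewicz (ringDeficit_eq_sums)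

namespace Summit.QuantumFields.YangMills.Theorems.VirialFluxGap.ChartPhase

variable {L : ℕ} [NeZero L]

/-! ## §1 The deficit as three families of unitary costs, in matrix form -/

/- In `SU(2)` the inverse is the adjoint as matrices, `↑(X⁻¹) = (↑X)ᴴ` — by `rfl`; used inline below (it is landed elsewhere, e.g.
`BalabanLadderUVSeamRecClassicalResponseThermalFloorOneLink.coe_inv_eq_conjTranspose`, whose module is not imported here). -/

/-- `Re tr ρ(U V⁻¹) = Re tr(U Vᴴ)` in the fundamental representation. [folklore] -/
theorem re_trace_su2Rep_mul_inv_eq_matrix (U V : SU2) :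
    ((su2Rep (U * V⁻¹)).trace).re = (((U : Matrix (Fin 2) (Fin 2) ℂ) * (V : Matrix (Fin 2) (Fin 2) ℂ)ᴴ).trace).re := by
  have coe_inv_su2 : ∀ X : SU2, ((X⁻¹ : SU2) : Matrix (Fin 2) (Fin 2) ℂ) = (X : Matrix (Fin 2) (Fin 2) ℂ)ᴴ := fun _ => rfl
  rw [fundamentalRep_apply, Submonoid.coe_mul, coe_inv_su2]

/-- The kinetic bond deficit as a sum of unitary costs: `6L³ − timeCoupling(U, V) = Σ_e (2 − Re tr(U_e V_eᴴ))`. [folklore] -/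
theorem timeCoupling_deficit_eq_matrix_sum (U V : GaugeConfig 3 L SU2) :
    6 * (L : ℝ) ^ 3 - timeCoupling su2Rep U V =
      ∑ e : Edge 3 L, ((2 : ℝ) - (((U e : Matrix (Fin 2) (Fin 2) ℂ) * (V e : Matrix (Fin 2) (Fin 2) ℂ)ᴴ).trace).re) := by
  have hcard : Fintype.card (Edge 3 L) = 3 * L ^ 3 := by
    rw [Fintype.card_prod, Fintype.card_pi, Finset.prod_const, Finset.card_univ, Fintype.card_fin, ZMod.card]; ring
  unfold timeCoupling
  rw [Finset.sum_sub_distrib, Finset.sum_const, Finset.card_univ, nsmul_eq_mul, hcard]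
  push_cast
  rw [Finset.sum_congr rfl fun e _ => re_trace_su2Rep_mul_inv_eq_matrix (U e) (V e)]
  ring

/-- The number of plaquettes of the three-torus: `3L³`. [folklore] -/
theorem card_plaquette_three : Fintype.card (Plaquette 3 L) = 3 * L ^ 3 := by
  have h3 : Fintype.card {p : Fin 3 × Fin 3 // p.1 < p.2} = 3 := by decide
  rw [Fintype.card_prod, Fintype.card_pi, Finset.prod_const, Finset.card_univ, Fintype.card_fin, ZMod.card, h3]
  ring

/-- Fin re-summation: `Σ_{i<n} ½(f(i) + f(i+1)) + ½(f(n) + f(0)) = Σ_{j≤n} f(j)`. [folklore] -/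
theorem sum_half_add_half_eq {n : ℕ} (f : Fin (n + 1) → ℝ) :
    (∑ i : Fin n, (1 / 2 : ℝ) * (f i.castSucc + f i.succ)) + (1 / 2 : ℝ) * (f (Fin.last n) + f 0) = ∑ j : Fin (n + 1), f j := by
  have h1 : ∑ j : Fin (n + 1), f j = (∑ i : Fin n, f i.castSucc) + f (Fin.last n) := Fin.sum_univ_castSucc f
  have h2 : ∑ j : Fin (n + 1), f j = f 0 + ∑ i : Fin n, f i.succ := Fin.sum_univ_succ f
  have h3 : ∑ i : Fin n, (1 / 2 : ℝ) * (f i.castSucc + f i.succ) = (1 / 2 : ℝ) * ((∑ i : Fin n, f i.castSucc) + ∑ i : Fin n, f i.succ) := by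
    rw [← Finset.mul_sum, Finset.sum_add_distrib]
  rw [h3]
  linarith

/-- ★ **The twisted deficit as three families of unitary costs.**  For EVERY ring history `P` and every twist `z`:
`F_z(P) = Σ_{i<2L−1} Σ_e (2 − Re tr(P_{i,e} P_{i+1,e}ᴴ)) + Σ_e (2 − Re tr(P_{2L−1,e} ((g·tw_z P_0)_e)ᴴ)) + Σ_{i≤2L−1} S(P_i)`. [cite: Luscher1983, §2] -/
theorem ringDeficit_eq_matrix_sums (z : Fin 3 → Bool) (P : (Fin (2 * L - 1 + 1) → GaugeConfig 3 L SU2) × (Site 3 L → SU2)) :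
    ringDeficit L z P =
      (∑ i : Fin (2 * L - 1), ∑ e : Edge 3 L,
          ((2 : ℝ) - (((P.1 i.castSucc e : Matrix (Fin 2) (Fin 2) ℂ) * (P.1 i.succ e : Matrix (Fin 2) (Fin 2) ℂ)ᴴ).trace).re)) +
      (∑ e : Edge 3 L, ((2 : ℝ) - (((P.1 (Fin.last (2 * L - 1)) e : Matrix (Fin 2) (Fin 2) ℂ) *
          ((gaugeTransform P.2 (twist3 z (P.1 0)) e : SU2) : Matrix (Fin 2) (Fin 2) ℂ)ᴴ).trace).re)) +
      ∑ j : Fin (2 * L - 1 + 1), wilsonAction su2Rep (P.1 j) := by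
  rw [ringDeficit_eq_sums]
  have hS : wilsonAction su2Rep (gaugeTransform P.2 (twist3 z (P.1 0))) = wilsonAction su2Rep (P.1 0) := by
    rw [wilsonAction_gaugeTransform]
    simp only [twist3]
    rw [wilsonAction_twist_of_mem_center su2Rep 0 (centreElem_mem_center _), wilsonAction_twist_of_mem_center su2Rep 1 (centreElem_mem_center _),
      wilsonAction_twist_of_mem_center su2Rep 2 (centreElem_mem_center _)]
  rw [hS, add_assoc, sum_half_add_half_eq (fun j => wilsonAction su2Rep (P.1 j))]
  congr 1
  · congr 1
    · exact Finset.sum_congr rfl fun i _ => timeCoupling_deficit_eq_matrix_sum _ _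
    · exact timeCoupling_deficit_eq_matrix_sum _ _

/-! ## §2 The three families against their cubic models -/

/-- A sum of terms each within `c` of its model is within `card · c` of the model sum. [folklore] -/
theorem abs_sum_sub_sum_le_card_mul {ι : Type*} [Fintype ι] {f g : ι → ℝ} {c : ℝ} (h : ∀ i, |f i - g i| ≤ c) :
    |(∑ i, f i) - ∑ i, g i| ≤ Fintype.card ι * c := by
  rw [← Finset.sum_sub_distrib]
  calc |∑ i, (f i - g i)| ≤ ∑ i, |f i - g i| := Finset.abs_sum_le_sum_abs _ _
    _ ≤ ∑ _i : ι, c := Finset.sum_le_sum fun i _ => h i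
    _ = Fintype.card ι * c := by rw [Finset.sum_const, Finset.card_univ, nsmul_eq_mul]

/-- ★ **Temporal family.**  In the chart `P_{i,e} = e^{A_{i,e}} R_{0,e}` at a background with equal slices:
`|Σ_{i,e} (2 − Re tr(P_{i,e}P_{i+1,e}ᴴ)) − Σ_{i,e} (½‖A_{i,e} − A_{i+1,e}‖² + ½Re tr((A_{i,e} − A_{i+1,e})(A_{i,e}A_{i+1,e} − A_{i+1,e}A_{i,e})))| ≤ #·560m⁴`.
[cite: Luscher1983, §2] -/
theorem abs_temporalFamily_sub_le {R P : (Fin (2 * L - 1 + 1) → GaugeConfig 3 L SU2) × (Site 3 L → SU2)}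
    (A : Fin (2 * L - 1 + 1) → Edge 3 L → Matrix (Fin 2) (Fin 2) ℂ)
    (hA : ∀ i e, (A i e)ᴴ = -A i e) {m : ℝ} (hm : m ≤ 1 / 4) (hAm : ∀ i e, ‖A i e‖ ≤ m)
    (hP1 : ∀ i e, (P.1 i e : Matrix (Fin 2) (Fin 2) ℂ) = exp (A i e) * (R.1 0 e : Matrix (Fin 2) (Fin 2) ℂ)) :
    |(∑ i : Fin (2 * L - 1), ∑ e : Edge 3 L,
        ((2 : ℝ) - (((P.1 i.castSucc e : Matrix (Fin 2) (Fin 2) ℂ) * (P.1 i.succ e : Matrix (Fin 2) (Fin 2) ℂ)ᴴ).trace).re)) -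
      ∑ i : Fin (2 * L - 1), ∑ e : Edge 3 L,
        (‖A i.castSucc e - A i.succ e‖ ^ 2 / 2 +
          ((A i.castSucc e - A i.succ e) * (A i.castSucc e * A i.succ e - A i.succ e * A i.castSucc e)).trace.re / 2)| ≤
      Fintype.card (Fin (2 * L - 1)) * (Fintype.card (Edge 3 L) * (560 * m ^ 4)) := by
  refine abs_sum_sub_sum_le_card_mul fun i => abs_sum_sub_sum_le_card_mul fun e => ?_
  have hU : (R.1 0 e : Matrix (Fin 2) (Fin 2) ℂ) ∈ Matrix.unitaryGroup (Fin 2) ℂ := (R.1 0 e).prop.1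
  have h := abs_cost_temporal_sub_cubic_le (N := 2) hU (hA i.castSucc e) (hA i.succ e) hm (hAm i.castSucc e) (hAm i.succ e)
  rw [hP1, hP1]
  have e2 : ((2 : ℕ) : ℝ) = 2 := by norm_num
  rw [e2] at h
  rw [← sub_sub]
  exact h

/-- ★ **Seam family.**  At a zero `R = ((U)_i; g)` of `F_z` (seam condition `g·tw_z U = U`), in the chart `P_{i,e} = e^{A_{i,e}}U_e`,
`g'_x = e^{B_x}g_x`, with the transports `X₂(e) = U_e B_{x+k} U_eᴴ`, `X₃(e) = W_e A_{0,e} W_eᴴ`, `W_e = U_e g_{x+k} U_eᴴ` (`e = (x,k)`):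
`|Σ_e (2 − Re tr(P_{2L−1,e}((g'·tw_z P_0)_e)ᴴ)) − Σ_e (½‖S_e‖² − ½Re tr(S_e K_e))| ≤ #·560m⁴`, `S_e = A_{2L−1,e} + X₂(e) − X₃(e) − B_x`. [cite: Luscher1983, §2] -/
theorem abs_seamFamily_sub_le (z : Fin 3 → Bool) {R P : (Fin (2 * L - 1 + 1) → GaugeConfig 3 L SU2) × (Site 3 L → SU2)}
    (hseamR : gaugeTransform R.2 (twist3 z (R.1 0)) = R.1 0)
    (A : Fin (2 * L - 1 + 1) → Edge 3 L → Matrix (Fin 2) (Fin 2) ℂ) (B : Site 3 L → Matrix (Fin 2) (Fin 2) ℂ)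
    (hA : ∀ i e, (A i e)ᴴ = -A i e) (hB : ∀ x, (B x)ᴴ = -B x) {m : ℝ} (hm : m ≤ 1 / 4) (hAm : ∀ i e, ‖A i e‖ ≤ m) (hBm : ∀ x, ‖B x‖ ≤ m)
    (hP1 : ∀ i e, (P.1 i e : Matrix (Fin 2) (Fin 2) ℂ) = exp (A i e) * (R.1 0 e : Matrix (Fin 2) (Fin 2) ℂ))
    (hP2 : ∀ x, (P.2 x : Matrix (Fin 2) (Fin 2) ℂ) = exp (B x) * (R.2 x : Matrix (Fin 2) (Fin 2) ℂ))
    (X₂ X₃ : Edge 3 L → Matrix (Fin 2) (Fin 2) ℂ)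
    (hX₂ : ∀ e, X₂ e = (R.1 0 e : Matrix (Fin 2) (Fin 2) ℂ) * B (e.1.shift e.2) * (R.1 0 e : Matrix (Fin 2) (Fin 2) ℂ)ᴴ)
    (hX₃ : ∀ e, X₃ e = ((R.1 0 e : Matrix (Fin 2) (Fin 2) ℂ) * (R.2 (e.1.shift e.2) : Matrix (Fin 2) (Fin 2) ℂ) * (R.1 0 e : Matrix (Fin 2) (Fin 2) ℂ)ᴴ) *
        A 0 e * ((R.1 0 e : Matrix (Fin 2) (Fin 2) ℂ) * (R.2 (e.1.shift e.2) : Matrix (Fin 2) (Fin 2) ℂ) * (R.1 0 e : Matrix (Fin 2) (Fin 2) ℂ)ᴴ)ᴴ) :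
    |(∑ e : Edge 3 L, ((2 : ℝ) - (((P.1 (Fin.last (2 * L - 1)) e : Matrix (Fin 2) (Fin 2) ℂ) *
          ((gaugeTransform P.2 (twist3 z (P.1 0)) e : SU2) : Matrix (Fin 2) (Fin 2) ℂ)ᴴ).trace).re)) -
      ∑ e : Edge 3 L,
        (‖A (Fin.last (2 * L - 1)) e + X₂ e - X₃ e - B e.1‖ ^ 2 / 2 -
          ((A (Fin.last (2 * L - 1)) e + X₂ e - X₃ e - B e.1) *
            ((A (Fin.last (2 * L - 1)) e * X₂ e - X₂ e * A (Fin.last (2 * L - 1)) e) -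
              (A (Fin.last (2 * L - 1)) e * X₃ e - X₃ e * A (Fin.last (2 * L - 1)) e) -
              (A (Fin.last (2 * L - 1)) e * B e.1 - B e.1 * A (Fin.last (2 * L - 1)) e) - (X₂ e * X₃ e - X₃ e * X₂ e) -
              (X₂ e * B e.1 - B e.1 * X₂ e) + (X₃ e * B e.1 - B e.1 * X₃ e))).trace.re / 2)| ≤
      Fintype.card (Edge 3 L) * (560 * m ^ 4) := by
  refine abs_sum_sub_sum_le_card_mul fun e => ?_
  obtain ⟨x, k⟩ := e
  -- the twist factor on this edge and the seam condition as a background holonomy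
  set s : SU2 := (if x k = 0 then centreElem (z k) else 1) with hs
  have htw : ∀ V : GaugeConfig 3 L SU2, twist3 z V (x, k) = s * V (x, k) := fun V => by rw [twist3_apply]
  have hGT : ∀ (h : Site 3 L → SU2) (V : GaugeConfig 3 L SU2), gaugeTransform h V (x, k) = h x * V (x, k) * (h (x.shift k))⁻¹ :=
    fun _ _ => rfl
  have coe_inv_su2 : ∀ X : SU2, ((X⁻¹ : SU2) : Matrix (Fin 2) (Fin 2) ℂ) = (X : Matrix (Fin 2) (Fin 2) ℂ)ᴴ := fun _ => rfl
  have hU : (R.1 0 (x, k) : Matrix (Fin 2) (Fin 2) ℂ) ∈ Matrix.unitaryGroup (Fin 2) ℂ := (R.1 0 (x, k)).prop.1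
  have hg₁u : (R.2 (x.shift k) : Matrix (Fin 2) (Fin 2) ℂ) ∈ Matrix.unitaryGroup (Fin 2) ℂ := (R.2 (x.shift k)).prop.1
  have hseam_e : R.2 x * (s * R.1 0 (x, k)) * (R.2 (x.shift k))⁻¹ = R.1 0 (x, k) := by
    have h := congrFun hseamR (x, k)
    rwa [hGT, htw] at h
  have hhol : (R.1 0 (x, k) : Matrix (Fin 2) (Fin 2) ℂ) * (R.2 (x.shift k) : Matrix (Fin 2) (Fin 2) ℂ) *
      (R.1 0 (x, k) : Matrix (Fin 2) (Fin 2) ℂ)ᴴ * ((R.2 x : Matrix (Fin 2) (Fin 2) ℂ) * (s : Matrix (Fin 2) (Fin 2) ℂ))ᴴ = 1 := by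
    have h0 : R.2 x * s * R.1 0 (x, k) = R.1 0 (x, k) * R.2 (x.shift k) := by
      have h := congrArg (· * R.2 (x.shift k)) hseam_e
      simpa only [mul_assoc, inv_mul_cancel, mul_one] using h
    have h1 : R.1 0 (x, k) * R.2 (x.shift k) * (R.1 0 (x, k))⁻¹ * (R.2 x * s)⁻¹ = 1 := by
      rw [← h0]; group
    have h2 := congrArg (fun X : SU2 => (X : Matrix (Fin 2) (Fin 2) ℂ)) h1
    simpa only [Submonoid.coe_mul, coe_inv_su2, OneMemClass.coe_one, Matrix.conjTranspose_mul] using h2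
  -- the word in chart coordinates
  have hword : (P.1 (Fin.last (2 * L - 1)) (x, k) : Matrix (Fin 2) (Fin 2) ℂ) *
        ((gaugeTransform P.2 (twist3 z (P.1 0)) (x, k) : SU2) : Matrix (Fin 2) (Fin 2) ℂ)ᴴ =
      exp (A (Fin.last (2 * L - 1)) (x, k)) * (R.1 0 (x, k) : Matrix (Fin 2) (Fin 2) ℂ) *
        (exp (B (x.shift k)) * (R.2 (x.shift k) : Matrix (Fin 2) (Fin 2) ℂ)) *
        (exp (A 0 (x, k)) * (R.1 0 (x, k) : Matrix (Fin 2) (Fin 2) ℂ))ᴴ *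
        (exp (B x) * ((R.2 x : Matrix (Fin 2) (Fin 2) ℂ) * (s : Matrix (Fin 2) (Fin 2) ℂ)))ᴴ := by
    rw [hGT, htw]
    simp only [Submonoid.coe_mul, coe_inv_su2]
    rw [hP1, hP1, hP2, hP2]
    simp only [Matrix.conjTranspose_mul, Matrix.conjTranspose_conjTranspose, Matrix.mul_assoc]
  rw [hword]
  have h := abs_cost_perturbed_holonomy_sub_cubic_le (N := 2) hU hg₁u hU hhol (hA (Fin.last (2 * L - 1)) (x, k)) (hB (x.shift k))
    (hA 0 (x, k)) (hB x) hm (hAm (Fin.last (2 * L - 1)) (x, k)) (hBm (x.shift k)) (hAm 0 (x, k)) (hBm x) (hX₂ (x, k)) (hX₃ (x, k))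
  have e2 : ((2 : ℕ) : ℝ) = 2 := by norm_num
  rw [e2] at h
  rw [← sub_add]
  exact h

/-- ★ **Plaquette family.**  At a background with equal FLAT slices, in the chart `P_{i,e} = e^{A_{i,e}}U_e`, with the transports
`X₂(i,p) = U₁ A_{i,(x+μ,ν)} U₁ᴴ`, `X₃(i,p) = W A_{i,(x+ν,μ)} Wᴴ`, `U₁ = U_{x,μ}`, `W = U_{x,μ}U_{x+μ,ν}U_{x+ν,μ}ᴴ` (`p = (x, μ<ν)`):
`|Σ_i S(P_i) − Σ_{i,p} (½‖S_{i,p}‖² − ½Re tr(S_{i,p} K_{i,p}))| ≤ #·560m⁴`, `S_{i,p} = A_{i,(x,μ)} + X₂ − X₃ − A_{i,(x,ν)}` (the covariant lattice curl).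
[cite: Luscher1983, §2] -/
theorem abs_plaquetteFamily_sub_le {R P : (Fin (2 * L - 1 + 1) → GaugeConfig 3 L SU2) × (Site 3 L → SU2)}
    (hflat : wilsonAction su2Rep (R.1 0) = 0)
    (A : Fin (2 * L - 1 + 1) → Edge 3 L → Matrix (Fin 2) (Fin 2) ℂ)
    (hA : ∀ i e, (A i e)ᴴ = -A i e) {m : ℝ} (hm : m ≤ 1 / 4) (hAm : ∀ i e, ‖A i e‖ ≤ m)
    (hP1 : ∀ i e, (P.1 i e : Matrix (Fin 2) (Fin 2) ℂ) = exp (A i e) * (R.1 0 e : Matrix (Fin 2) (Fin 2) ℂ))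
    (X₂ X₃ : Fin (2 * L - 1 + 1) → Plaquette 3 L → Matrix (Fin 2) (Fin 2) ℂ)
    (hX₂ : ∀ i p, X₂ i p = (R.1 0 (p.1, p.2.1.1) : Matrix (Fin 2) (Fin 2) ℂ) * A i (p.1.shift p.2.1.1, p.2.1.2) *
        (R.1 0 (p.1, p.2.1.1) : Matrix (Fin 2) (Fin 2) ℂ)ᴴ)
    (hX₃ : ∀ i p, X₃ i p = ((R.1 0 (p.1, p.2.1.1) : Matrix (Fin 2) (Fin 2) ℂ) * (R.1 0 (p.1.shift p.2.1.1, p.2.1.2) : Matrix (Fin 2) (Fin 2) ℂ) *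
          (R.1 0 (p.1.shift p.2.1.2, p.2.1.1) : Matrix (Fin 2) (Fin 2) ℂ)ᴴ) * A i (p.1.shift p.2.1.2, p.2.1.1) *
        ((R.1 0 (p.1, p.2.1.1) : Matrix (Fin 2) (Fin 2) ℂ) * (R.1 0 (p.1.shift p.2.1.1, p.2.1.2) : Matrix (Fin 2) (Fin 2) ℂ) *
          (R.1 0 (p.1.shift p.2.1.2, p.2.1.1) : Matrix (Fin 2) (Fin 2) ℂ)ᴴ)ᴴ) :
    |(∑ i : Fin (2 * L - 1 + 1), wilsonAction su2Rep (P.1 i)) -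
      ∑ i : Fin (2 * L - 1 + 1), ∑ p : Plaquette 3 L,
        (‖A i (p.1, p.2.1.1) + X₂ i p - X₃ i p - A i (p.1, p.2.1.2)‖ ^ 2 / 2 -
          ((A i (p.1, p.2.1.1) + X₂ i p - X₃ i p - A i (p.1, p.2.1.2)) *
            ((A i (p.1, p.2.1.1) * X₂ i p - X₂ i p * A i (p.1, p.2.1.1)) - (A i (p.1, p.2.1.1) * X₃ i p - X₃ i p * A i (p.1, p.2.1.1)) -
              (A i (p.1, p.2.1.1) * A i (p.1, p.2.1.2) - A i (p.1, p.2.1.2) * A i (p.1, p.2.1.1)) - (X₂ i p * X₃ i p - X₃ i p * X₂ i p) -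
              (X₂ i p * A i (p.1, p.2.1.2) - A i (p.1, p.2.1.2) * X₂ i p) + (X₃ i p * A i (p.1, p.2.1.2) - A i (p.1, p.2.1.2) * X₃ i p))).trace.re / 2)| ≤
      Fintype.card (Fin (2 * L - 1 + 1)) * (Fintype.card (Plaquette 3 L) * (560 * m ^ 4)) := by
  refine abs_sum_sub_sum_le_card_mul fun i => ?_
  unfold wilsonAction
  refine abs_sum_sub_sum_le_card_mul fun p => ?_
  obtain ⟨x, ⟨⟨μ, ν⟩, hμν⟩⟩ := p
  simp only
  -- background links and the flat background holonomy
  set U₁ : Matrix (Fin 2) (Fin 2) ℂ := (R.1 0 (x, μ) : Matrix (Fin 2) (Fin 2) ℂ) with hU₁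
  set U₂ : Matrix (Fin 2) (Fin 2) ℂ := (R.1 0 (x.shift μ, ν) : Matrix (Fin 2) (Fin 2) ℂ) with hU₂
  set U₃ : Matrix (Fin 2) (Fin 2) ℂ := (R.1 0 (x.shift ν, μ) : Matrix (Fin 2) (Fin 2) ℂ) with hU₃
  set U₄ : Matrix (Fin 2) (Fin 2) ℂ := (R.1 0 (x, ν) : Matrix (Fin 2) (Fin 2) ℂ) with hU₄
  have coe_inv_su2 : ∀ X : SU2, ((X⁻¹ : SU2) : Matrix (Fin 2) (Fin 2) ℂ) = (X : Matrix (Fin 2) (Fin 2) ℂ)ᴴ := fun _ => rfl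
  have h₁ : U₁ ∈ Matrix.unitaryGroup (Fin 2) ℂ := (R.1 0 (x, μ)).prop.1
  have h₂ : U₂ ∈ Matrix.unitaryGroup (Fin 2) ℂ := (R.1 0 (x.shift μ, ν)).prop.1
  have h₃ : U₃ ∈ Matrix.unitaryGroup (Fin 2) ℂ := (R.1 0 (x.shift ν, μ)).prop.1
  have hholSU : ((plaquetteHolonomy (R.1 0) x μ ν : SU2) : Matrix (Fin 2) (Fin 2) ℂ) = U₁ * U₂ * U₃ᴴ * U₄ᴴ := by
    simp only [plaquetteHolonomy, Submonoid.coe_mul, coe_inv_su2, hU₁, hU₂, hU₃, hU₄]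
  have hhol : U₁ * U₂ * U₃ᴴ * U₄ᴴ = 1 := by
    -- each plaquette cost of the flat slice vanishes
    have hnn : ∀ q ∈ (Finset.univ : Finset (Plaquette 3 L)),
        0 ≤ ((2 : ℕ) : ℝ) - ((su2Rep (plaquetteHolonomy (R.1 0) q.1 q.2.1.1 q.2.1.2)).trace).re := fun q _ => by
      rw [fundamentalRep_apply, sub_re_trace_eq_half_norm_sub_one_sq (plaquetteHolonomy (R.1 0) q.1 q.2.1.1 q.2.1.2).prop.1]; positivity
    have h0 := (Finset.sum_eq_zero_iff_of_nonneg hnn).1 hflat ⟨x, ⟨⟨μ, ν⟩, hμν⟩⟩ (Finset.mem_univ _)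
    simp only at h0
    rw [fundamentalRep_apply, sub_re_trace_eq_half_norm_sub_one_sq (plaquetteHolonomy (R.1 0) x μ ν).prop.1, hholSU] at h0
    have h1 : ‖U₁ * U₂ * U₃ᴴ * U₄ᴴ - 1‖ = 0 := by nlinarith [norm_nonneg (U₁ * U₂ * U₃ᴴ * U₄ᴴ - 1)]
    exact sub_eq_zero.1 (norm_eq_zero.1 h1)
  -- the word in chart coordinates
  have hword : (su2Rep (plaquetteHolonomy (P.1 i) x μ ν) : Matrix (Fin 2) (Fin 2) ℂ) =
      exp (A i (x, μ)) * U₁ * (exp (A i (x.shift μ, ν)) * U₂) * (exp (A i (x.shift ν, μ)) * U₃)ᴴ * (exp (A i (x, ν)) * U₄)ᴴ := by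
    rw [fundamentalRep_apply]
    simp only [plaquetteHolonomy, Submonoid.coe_mul, coe_inv_su2, hP1, hU₁, hU₂, hU₃, hU₄]
  rw [hword]
  have h := abs_cost_perturbed_holonomy_sub_cubic_le (N := 2) h₁ h₂ h₃ hhol (hA i (x, μ)) (hA i (x.shift μ, ν)) (hA i (x.shift ν, μ))
    (hA i (x, ν)) hm (hAm i (x, μ)) (hAm i (x.shift μ, ν)) (hAm i (x.shift ν, μ)) (hAm i (x, ν)) (hX₂ i ⟨x, ⟨⟨μ, ν⟩, hμν⟩⟩)
    (hX₃ i ⟨x, ⟨⟨μ, ν⟩, hμν⟩⟩)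
  rw [← sub_add]
  exact h

/-! ## §3 ★★ The assembly: deficit = quadratic form − odd cubic form + `O(L⁴m⁴)` -/

/-- The quadratic piece of a term is even and the cubic piece is odd under `X ↦ −X` (parity bookkeeping for the consumer). [folklore] -/
theorem cubicPiece_neg (X₁ X₂ X₃ X₄ : Matrix (Fin 2) (Fin 2) ℂ) :
    ((-X₁ + -X₂ - -X₃ - -X₄) * ((-X₁ * -X₂ - -X₂ * -X₁) - (-X₁ * -X₃ - -X₃ * -X₁) - (-X₁ * -X₄ - -X₄ * -X₁) - (-X₂ * -X₃ - -X₃ * -X₂) -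
          (-X₂ * -X₄ - -X₄ * -X₂) + (-X₃ * -X₄ - -X₄ * -X₃))).trace.re / 2 =
      -(((X₁ + X₂ - X₃ - X₄) * ((X₁ * X₂ - X₂ * X₁) - (X₁ * X₃ - X₃ * X₁) - (X₁ * X₄ - X₄ * X₁) - (X₂ * X₃ - X₃ * X₂) -
          (X₂ * X₄ - X₄ * X₂) + (X₃ * X₄ - X₄ * X₃))).trace.re / 2) := by
  have e : (-X₁ + -X₂ - -X₃ - -X₄) * ((-X₁ * -X₂ - -X₂ * -X₁) - (-X₁ * -X₃ - -X₃ * -X₁) - (-X₁ * -X₄ - -X₄ * -X₁) -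
      (-X₂ * -X₃ - -X₃ * -X₂) - (-X₂ * -X₄ - -X₄ * -X₂) + (-X₃ * -X₄ - -X₄ * -X₃)) =
      -((X₁ + X₂ - X₃ - X₄) * ((X₁ * X₂ - X₂ * X₁) - (X₁ * X₃ - X₃ * X₁) - (X₁ * X₄ - X₄ * X₁) - (X₂ * X₃ - X₃ * X₂) -
          (X₂ * X₄ - X₄ * X₂) + (X₃ * X₄ - X₄ * X₃))) := by noncomm_ring
  rw [e, Matrix.trace_neg, Complex.neg_re, neg_div]

/-- The quadratic piece is even under `X ↦ −X`. [folklore] -/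
theorem quadPiece_neg (X₁ X₂ X₃ X₄ : Matrix (Fin 2) (Fin 2) ℂ) : ‖-X₁ + -X₂ - -X₃ - -X₄‖ ^ 2 / 2 = ‖X₁ + X₂ - X₃ - X₄‖ ^ 2 / 2 := by
  have e : -X₁ + -X₂ - -X₃ - -X₄ = -(X₁ + X₂ - X₃ - X₄) := by abel
  rw [e, norm_neg]

/-- Three family errors add up. [folklore] -/
theorem abs_add_three_sub_le {a b c a' b' c' : ℝ} : |a + b + c - (a' + b' + c')| ≤ |a - a'| + |b - b'| + |c - c'| := by
  have e : a + b + c - (a' + b' + c') = (a - a') + (b - b') + (c - c') := by ring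
  rw [e]
  exact (abs_add_le _ _).trans (add_le_add (abs_add_le _ _) le_rfl)

/-- The term count: `(2L−1)·3L³ + 3L³ + 2L·3L³ = 12L⁴` unit costs, each within `560m⁴` of its model. [folklore] -/
theorem familyCards_mul_eq (L : ℕ) [NeZero L] (c : ℝ) :
    (Fintype.card (Fin (2 * L - 1)) : ℝ) * ((Fintype.card (Edge 3 L) : ℝ) * c) + (Fintype.card (Edge 3 L) : ℝ) * c +
      (Fintype.card (Fin (2 * L - 1 + 1)) : ℝ) * ((Fintype.card (Plaquette 3 L) : ℝ) * c) = 12 * (L : ℝ) ^ 4 * c := by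
  have hE : Fintype.card (Edge 3 L) = 3 * L ^ 3 := by
    rw [Fintype.card_prod, Fintype.card_pi, Finset.prod_const, Finset.card_univ, Fintype.card_fin, ZMod.card]; ring
  have hL1 : 1 ≤ L := NeZero.one_le
  have h2L : ((2 * L - 1 : ℕ) : ℝ) = 2 * (L : ℝ) - 1 := by
    rw [Nat.cast_sub (by omega), Nat.cast_mul]; norm_num
  rw [Fintype.card_fin, Fintype.card_fin, hE, card_plaquette_three, Nat.sub_add_cancel (by omega), h2L]
  push_cast
  ring

/-- ★★ **The twisted ring deficit in the product exponential chart at a zero.**  Let `R = ((U)_i; g)` be a zero of `F_z` and `P` the ring with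
`P_{i,e} = e^{A_{i,e}}U_e`, `g'_x = e^{B_x}g_x` (as matrices) for skew-Hermitian `A_{i,e}`, `B_x` of Frobenius norm `≤ m ≤ 1/4`; let `X₂, X₃` (seam)
and `Y₂, Y₃` (plaquettes) be the transported perturbations.  Then
`|F_z(P) − (Q(A,B) − C(A,B))| ≤ 6720·L⁴·m⁴`, where `Q = ½Σ_terms ‖S_t‖²` is the explicit QUADRATIC form and `C = ½Σ_terms ±Re tr(S_t K_t)` the
explicit (odd, ✓`cubicPiece_neg`) CUBIC form displayed below — the window datum `f∘σ = ½⟪Ay,y⟫ + c + r` of the quantitative Laplace method along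
any linear slice of the chart. [cite: Luscher1983, §2] [cite: Breitung1994, Lemma 7 p. 12] -/
theorem abs_ringDeficit_sub_chartModel_le (z : Fin 3 → Bool) {R P : (Fin (2 * L - 1 + 1) → GaugeConfig 3 L SU2) × (Site 3 L → SU2)}
    (hR : ringDeficit L z R = 0)
    (A : Fin (2 * L - 1 + 1) → Edge 3 L → Matrix (Fin 2) (Fin 2) ℂ) (B : Site 3 L → Matrix (Fin 2) (Fin 2) ℂ)
    (hA : ∀ i e, (A i e)ᴴ = -A i e) (hB : ∀ x, (B x)ᴴ = -B x) {m : ℝ} (hm : m ≤ 1 / 4) (hAm : ∀ i e, ‖A i e‖ ≤ m) (hBm : ∀ x, ‖B x‖ ≤ m)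
    (hP1 : ∀ i e, (P.1 i e : Matrix (Fin 2) (Fin 2) ℂ) = exp (A i e) * (R.1 0 e : Matrix (Fin 2) (Fin 2) ℂ))
    (hP2 : ∀ x, (P.2 x : Matrix (Fin 2) (Fin 2) ℂ) = exp (B x) * (R.2 x : Matrix (Fin 2) (Fin 2) ℂ))
    (X₂ X₃ : Edge 3 L → Matrix (Fin 2) (Fin 2) ℂ)
    (hX₂ : ∀ e, X₂ e = (R.1 0 e : Matrix (Fin 2) (Fin 2) ℂ) * B (e.1.shift e.2) * (R.1 0 e : Matrix (Fin 2) (Fin 2) ℂ)ᴴ)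
    (hX₃ : ∀ e, X₃ e = ((R.1 0 e : Matrix (Fin 2) (Fin 2) ℂ) * (R.2 (e.1.shift e.2) : Matrix (Fin 2) (Fin 2) ℂ) * (R.1 0 e : Matrix (Fin 2) (Fin 2) ℂ)ᴴ) *
        A 0 e * ((R.1 0 e : Matrix (Fin 2) (Fin 2) ℂ) * (R.2 (e.1.shift e.2) : Matrix (Fin 2) (Fin 2) ℂ) * (R.1 0 e : Matrix (Fin 2) (Fin 2) ℂ)ᴴ)ᴴ)
    (Y₂ Y₃ : Fin (2 * L - 1 + 1) → Plaquette 3 L → Matrix (Fin 2) (Fin 2) ℂ)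
    (hY₂ : ∀ i p, Y₂ i p = (R.1 0 (p.1, p.2.1.1) : Matrix (Fin 2) (Fin 2) ℂ) * A i (p.1.shift p.2.1.1, p.2.1.2) *
        (R.1 0 (p.1, p.2.1.1) : Matrix (Fin 2) (Fin 2) ℂ)ᴴ)
    (hY₃ : ∀ i p, Y₃ i p = ((R.1 0 (p.1, p.2.1.1) : Matrix (Fin 2) (Fin 2) ℂ) * (R.1 0 (p.1.shift p.2.1.1, p.2.1.2) : Matrix (Fin 2) (Fin 2) ℂ) *
          (R.1 0 (p.1.shift p.2.1.2, p.2.1.1) : Matrix (Fin 2) (Fin 2) ℂ)ᴴ) * A i (p.1.shift p.2.1.2, p.2.1.1) *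
        ((R.1 0 (p.1, p.2.1.1) : Matrix (Fin 2) (Fin 2) ℂ) * (R.1 0 (p.1.shift p.2.1.1, p.2.1.2) : Matrix (Fin 2) (Fin 2) ℂ) *
          (R.1 0 (p.1.shift p.2.1.2, p.2.1.1) : Matrix (Fin 2) (Fin 2) ℂ)ᴴ)ᴴ) :
    |ringDeficit L z P -
      (((∑ i : Fin (2 * L - 1), ∑ e : Edge 3 L, ‖A i.castSucc e - A i.succ e‖ ^ 2 / 2) +
          (∑ e : Edge 3 L, ‖A (Fin.last (2 * L - 1)) e + X₂ e - X₃ e - B e.1‖ ^ 2 / 2) +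
          ∑ i : Fin (2 * L - 1 + 1), ∑ p : Plaquette 3 L, ‖A i (p.1, p.2.1.1) + Y₂ i p - Y₃ i p - A i (p.1, p.2.1.2)‖ ^ 2 / 2) -
        ((∑ i : Fin (2 * L - 1), ∑ e : Edge 3 L,
            -(((A i.castSucc e - A i.succ e) * (A i.castSucc e * A i.succ e - A i.succ e * A i.castSucc e)).trace.re / 2)) +
          (∑ e : Edge 3 L,
            ((A (Fin.last (2 * L - 1)) e + X₂ e - X₃ e - B e.1) *
              ((A (Fin.last (2 * L - 1)) e * X₂ e - X₂ e * A (Fin.last (2 * L - 1)) e) -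
                (A (Fin.last (2 * L - 1)) e * X₃ e - X₃ e * A (Fin.last (2 * L - 1)) e) -
                (A (Fin.last (2 * L - 1)) e * B e.1 - B e.1 * A (Fin.last (2 * L - 1)) e) - (X₂ e * X₃ e - X₃ e * X₂ e) -
                (X₂ e * B e.1 - B e.1 * X₂ e) + (X₃ e * B e.1 - B e.1 * X₃ e))).trace.re / 2) +
          ∑ i : Fin (2 * L - 1 + 1), ∑ p : Plaquette 3 L,
            ((A i (p.1, p.2.1.1) + Y₂ i p - Y₃ i p - A i (p.1, p.2.1.2)) *
              ((A i (p.1, p.2.1.1) * Y₂ i p - Y₂ i p * A i (p.1, p.2.1.1)) - (A i (p.1, p.2.1.1) * Y₃ i p - Y₃ i p * A i (p.1, p.2.1.1)) -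
                (A i (p.1, p.2.1.1) * A i (p.1, p.2.1.2) - A i (p.1, p.2.1.2) * A i (p.1, p.2.1.1)) - (Y₂ i p * Y₃ i p - Y₃ i p * Y₂ i p) -
                (Y₂ i p * A i (p.1, p.2.1.2) - A i (p.1, p.2.1.2) * Y₂ i p) + (Y₃ i p * A i (p.1, p.2.1.2) - A i (p.1, p.2.1.2) * Y₃ i p))).trace.re / 2))| ≤
      6720 * (L : ℝ) ^ 4 * m ^ 4 := by
  obtain ⟨hall, hflat, hseamR⟩ := (ringDeficit_eq_zero_iff z R).mp hR
  have hT := abs_temporalFamily_sub_le (R := R) (P := P) A hA hm hAm hP1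
  have hS := abs_seamFamily_sub_le z (R := R) (P := P) hseamR A B hA hB hm hAm hBm hP1 hP2 X₂ X₃ hX₂ hX₃
  have hPl := abs_plaquetteFamily_sub_le (R := R) (P := P) hflat A hA hm hAm hP1 Y₂ Y₃ hY₂ hY₃
  rw [ringDeficit_eq_matrix_sums z P]
  -- regroup the model as (family sums of `quad ± cubic`)
  have eT : (∑ i : Fin (2 * L - 1), ∑ e : Edge 3 L, ‖A i.castSucc e - A i.succ e‖ ^ 2 / 2) -
      (∑ i : Fin (2 * L - 1), ∑ e : Edge 3 L,
        -(((A i.castSucc e - A i.succ e) * (A i.castSucc e * A i.succ e - A i.succ e * A i.castSucc e)).trace.re / 2)) =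
      ∑ i : Fin (2 * L - 1), ∑ e : Edge 3 L, (‖A i.castSucc e - A i.succ e‖ ^ 2 / 2 +
        ((A i.castSucc e - A i.succ e) * (A i.castSucc e * A i.succ e - A i.succ e * A i.castSucc e)).trace.re / 2) := by
    rw [← Finset.sum_sub_distrib]
    refine Finset.sum_congr rfl fun i _ => ?_
    rw [← Finset.sum_sub_distrib]
    refine Finset.sum_congr rfl fun e _ => ?_
    ring
  have eS : ∀ (q c : Edge 3 L → ℝ), (∑ e, q e) - (∑ e, c e) = ∑ e, (q e - c e) := fun q c => (Finset.sum_sub_distrib _ _).symm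
  have eP : ∀ (q c : Fin (2 * L - 1 + 1) → Plaquette 3 L → ℝ),
      (∑ i, ∑ p, q i p) - (∑ i, ∑ p, c i p) = ∑ i, ∑ p, (q i p - c i p) := fun q c => by
    rw [← Finset.sum_sub_distrib]
    exact Finset.sum_congr rfl fun i _ => (Finset.sum_sub_distrib _ _).symm
  have key : ∀ (a b c qa qb qc ca cb cc : ℝ),
      a + b + c - ((qa + qb + qc) - (ca + cb + cc)) = a + b + c - ((qa - ca) + (qb - cb) + (qc - cc)) := fun _ _ _ _ _ _ _ _ _ => by ring
  rw [key, eT, eS, eP]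
  refine abs_add_three_sub_le.trans ?_
  refine (add_le_add (add_le_add hT hS) hPl).trans ?_
  rw [familyCards_mul_eq L (560 * m ^ 4)]
  ring_nf
  exact le_rfl

end Summit.QuantumFields.YangMills.Theorems.VirialFluxGap.ChartPhase

end
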